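import Summits.KontsevichZagierPeriods.KontsevichZagierPeriods.Theses.TorsionLogs
import Summits.KontsevichZagierPeriods.KontsevichZagierPeriods.Theorems.HyperbolicBlochOffTetraSectorKernelRungZeroLogRelations
import Summits.KontsevichZagierPeriods.KontsevichZagierPeriods.Theorems.TorsionLogsNeronTorsionSectorStubParametersAlgebraic
import Summits.KontsevichZagierPeriods.KontsevichZagierPeriods.Theorems.TorsionLogsNeronTorsionFlexHeightChain
import Summits.KontsevichZagierPeriods.KontsevichZagierPeriods.Theorems.TorsionLogsNeronTorsionFlexHeightFlexTorsionData

/-!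
# Crux `TorsionLogs.NeronTorsionFlex` (stmt-KontsevichZagierPeriods-13806) — PROVED via line `NeronHeight`

The route-thesis conjunct `Summit.KontsevichZagierPeriods.KontsevichZagierPeriods.Theses.TorsionLogs.NeronTorsionFlex`
(the first explicit non-CM instance of the torsion sector: the flex `P` of `Y² = X³ − 7X + 6`, an explicit
Kontsevich–Zagier chain `36•[rI] + [rP] − 3•[rL] ∈ KZ.relations` with `rL = ∫_1^{f(x_P)²/125} dt/t`)
follows from the two stubs of the registered line `NeronHeight` (`Cruxes/NeronTorsionFlex/Lines/NeronHeight.lean`),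
both now Theorems:

* the RUNG `NeronTorsionHeightChain` = `TorsionLogs.NeronHeight.neronTorsion_height_chain`
  (`TorsionLogsNeronTorsionFlexHeightChain.lean`; Néron–torsion value identity
  `TorsionLogs.NeronHeight.neronTorsion_value_identity`, `TorsionLogsNeronTorsionFlexTorsionValue.lean`;
  on-path lander fwd2-land-3-g8), and
* the SUPPORT `FlexTorsionData` = `TorsionLogs.NeronHeight.flexTorsionData`
  (`TorsionLogsNeronTorsionFlexHeightFlexTorsionData.lean`, on-path lander fwd2-land-4-g18),

by the line's COMPOSITION `NeronTorsionFlex_of_stubs` (planner-fwd2-rung-KontsevichZagierPeriods-01-g7, proved in the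
skeleton; reproduced here verbatim up to the two stub names, since Theorems files cannot import crux workfiles):
instantiate the rung at `(g₂, g₃, e₁, N, a, p, q) = (28, −24, 2, 3, 1, 1, 6)`, read the pin
`c·log B = 12·log|y_P| − 9·log 5 = 3·log(f(x_P)²/125)` (`ψ₂(x, y/2) = y`, `D = 5`), get `x_P` algebraic from
the representation `rI` (`stub_parametersAlgebraic`), apply the landed interval-log relation
`interval_log_relation_mem_relations` to `c•[rB] − 3•[rL]`, and add in `KZ.relations`.

* `neronTorsionFlex : …Theses.TorsionLogs.NeronTorsionFlex` — closes stmt-KontsevichZagierPeriods-13806.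

prover-fwd2-land-3-g8-0 (on-path lander, gen 8), 2026-08-19; composition adapted from
`Cruxes/NeronTorsionFlex/Lines/NeronHeight.lean :: NeronTorsionFlex_of_stubs`.
-/

-- single-conjunct summit: Sub = Summit, so the namespace segment repeats by design (CONVENTIONS §2)
set_option linter.dupNamespace false

noncomputable section

namespace Summit.KontsevichZagierPeriods.KontsevichZagierPeriods.TorsionLogs.NeronHeight

open Literature.NumberTheory.Transcendental
open Summit.KontsevichZagierPeriods.HyperbolicBloch.OffTetraSectorKernel (interval_log_relation_mem_relations)
open Summit.KontsevichZagierPeriods.KontsevichZagierPeriods.Cruxes.NeronTorsionSector.Translation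
  (stub_parametersAlgebraic)

/-- **Crux `TorsionLogs.NeronTorsionFlex` (r3, L) — the flex of `Y² = X³ − 7X + 6` is an explicit
Kontsevich–Zagier chain**: for every real `x_P > 2` with `3x_P⁴ − 42x_P² + 72x_P − 49 = 0` and the three
representations `rI = ∫∫_{2<x′<x<x_P} x′/(√f√f)`, `rP = ∫∫_{x,x′>2} (√f(x))⁻¹(28x′−48)/(2x′²√f(x′))`,
`rL = ∫_1^{f(x_P)²/125} dt/t` (`f = 4x³ − 28x + 24`), `36•[rI] + [rP] − 3•[rL] ∈ KZ.relations`.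
Proof = the line `NeronHeight`: pinned Néron–torsion chain (`neronTorsion_height_chain`) at the 3-torsion flex
(`flexTorsionData`) + the interval-log relation; composition verbatim the skeleton's `NeronTorsionFlex_of_stubs`.
[cite: Silverman1994, Thm VI.3.2; KontsevichZagier2001, §1.2] -/
theorem neronTorsionFlex :
    Summit.KontsevichZagierPeriods.KontsevichZagierPeriods.Theses.TorsionLogs.NeronTorsionFlex := by
  have hrung := neronTorsion_height_chain
  have hflex := flexTorsionData
  intro xP hxP hψ rI rP rL hIdom hIint hPdom hPint hLdom hLint
  -- the flex curve `f(x) = 4x³ − 28x + 24 = 4(x−2)(x−1)(x+3)`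
  have hpos : ∀ x : ℝ, 2 < x → 0 < 4 * x ^ 3 - 28 * x + 24 := by
    intro x hx
    have h : 4 * x ^ 3 - 28 * x + 24 = 4 * ((x - 2) * (x - 1) * (x + 3)) := by ring
    rw [h]
    have h1 : 0 < x - 2 := sub_pos.2 hx
    have h2 : 0 < x - 1 := by linarith
    have h3 : 0 < x + 3 := by linarith
    positivity
  have hfP : 0 < 4 * xP ^ 3 - 28 * xP + 24 := hpos xP hxP
  have hyP2 : Real.sqrt (4 * xP ^ 3 - 28 * xP + 24) ^ 2 = 4 * xP ^ 3 - 28 * xP + 24 :=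
    Real.sq_sqrt hfP.le
  have hyPpos : 0 < Real.sqrt (4 * xP ^ 3 - 28 * xP + 24) := Real.sqrt_pos.2 hfP
  -- the flex root satisfies `x_P ≥ 5/2`, hence `f(x_P) ≥ 12` and `f(x_P)² ≥ 125`
  have ht : 1 / 2 ≤ xP - 2 := by
    by_contra h
    rw [not_le] at h
    have h0 : 0 < xP - 2 := sub_pos.2 hxP
    have h1 : (xP - 2) ^ 2 < 1 / 4 := by nlinarith
    have h2 : (xP - 2) ^ 3 < 1 / 8 := by nlinarith
    have h3 : (xP - 2) ^ 4 < 1 / 16 := by nlinarith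
    have hφ : 3 * (xP - 2) ^ 4 + 24 * (xP - 2) ^ 3 + 30 * (xP - 2) ^ 2 - 25 = 0 := by
      have : 3 * (xP - 2) ^ 4 + 24 * (xP - 2) ^ 3 + 30 * (xP - 2) ^ 2 - 25
          = 3 * xP ^ 4 - 42 * xP ^ 2 + 72 * xP - 49 := by ring
      rw [this, hψ]
    linarith
  have hf12 : 12 ≤ 4 * xP ^ 3 - 28 * xP + 24 := by
    have h0 : 0 < xP - 2 := sub_pos.2 hxP
    have : 4 * xP ^ 3 - 28 * xP + 24 = 20 * (xP - 2) + 24 * (xP - 2) ^ 2 + 4 * (xP - 2) ^ 3 := by ring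
    rw [this]; nlinarith
  have hsq : (1 : ℝ) ≤ (4 * xP ^ 3 - 28 * xP + 24) ^ 2 / 125 := by
    rw [le_div_iff₀ (by norm_num : (0:ℝ) < 125)]; nlinarith
  -- integrand conversion (`28·x′ − 48 = g₂·x′ + 2·g₃` with `g₂ = 28`, `g₃ = −24`)
  have hconv : (fun z : Fin 2 → ℝ => (Real.sqrt (4 * (z 0) ^ 3 - 28 * z 0 + 24))⁻¹ *
        ((28 * z 1 - 48) / (2 * (z 1) ^ 2 * Real.sqrt (4 * (z 1) ^ 3 - 28 * z 1 + 24))))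
      = (fun z : Fin 2 → ℝ => (Real.sqrt ((fun x : ℝ => 4 * x ^ 3 - 28 * x + 24) (z 0)))⁻¹ *
        (((28 : ℝ) * z 1 + 2 * (-24)) / (2 * (z 1) ^ 2 *
          Real.sqrt ((fun x : ℝ => 4 * x ^ 3 - 28 * x + 24) (z 1))))) := by
    funext z; norm_num [sub_eq_add_neg]
  have hPint' := hPint
  rw [hconv] at hPint'
  -- flex torsion data
  obtain ⟨htor, hper⟩ := hflex xP hxP hψ
  have hper' : ((3 : ℕ) : ℝ) * (∫ x in Set.Ioi xP,
        (Real.sqrt ((fun x : ℝ => 4 * x ^ 3 - 28 * x + 24) x))⁻¹) =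
      ((1 : ℕ) : ℝ) * (2 * ∫ x in Set.Ioi (2 : ℝ),
        (Real.sqrt ((fun x : ℝ => 4 * x ^ 3 - 28 * x + 24) x))⁻¹) := by
    simpa using hper
  -- algebraicity of `x_P` is forced by the representation `rI` (landed `stub_parametersAlgebraic`)
  have hxalg : IsAlgebraic ℚ xP :=
    (stub_parametersAlgebraic 28 (-24) 2 xP (fun x => 4 * x ^ 3 - 28 * x + 24) (fun x => by ring)
      (by norm_num) (by norm_num) hpos hxP rI rP hIdom hIint hPdom hPint').2.2.2
  have hfalg : IsAlgebraic ℚ ((4 * xP ^ 3 - 28 * xP + 24) ^ 2 / 125) := by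
    have h4 : IsAlgebraic ℚ ((4 : ℕ) : ℝ) := isAlgebraic_nat 4
    have h28 : IsAlgebraic ℚ ((28 : ℕ) : ℝ) := isAlgebraic_nat 28
    have h24 : IsAlgebraic ℚ ((24 : ℕ) : ℝ) := isAlgebraic_nat 24
    have h125 : IsAlgebraic ℚ ((125 : ℕ) : ℝ) := isAlgebraic_nat 125
    push_cast at h4 h28 h24 h125
    rw [div_eq_mul_inv]
    exact ((((h4.mul (hxalg.pow 3)).sub (h28.mul hxalg)).add h24).pow 2).mul h125.inv
  -- the rung at the flex: `(g₂, g₃, e₁, N, a, p, q) = (28, −24, 2, 3, 1, 1, 6)`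
  obtain ⟨c, B, rB, hB1, hBalg, hBdom, hBint, hchain, hpin⟩ :=
    hrung 28 (-24) 2 xP (Real.sqrt (4 * xP ^ 3 - 28 * xP + 24)) 3 1 1 6
      (fun x => 4 * x ^ 3 - 28 * x + 24) (fun x => by ring) (by norm_num) (by norm_num) (by norm_num)
      hpos hxP hyP2 le_rfl one_pos (by norm_num) htor hper' (by norm_num) (by norm_num)
      rI rP hIdom hIint hPdom hPint'
  have hchain' : (36 : ℤ) • KZ.of rI + KZ.of rP - c • KZ.of rB ∈ KZ.relations := by
    simpa using hchain
  -- the pin at the flex: `ψ₂(x_P, y_P/2) = y_P`, `D = 5`, so `c·log B = 12·log y_P − 9·log 5`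
  have hψ₂ : (((⟨0, 0, 0, -28 / 4, -(-24) / 4⟩ : WeierstrassCurve ℝ).ψ (((3 : ℕ) : ℤ) - 1)).evalEval xP
        (Real.sqrt (4 * xP ^ 3 - 28 * xP + 24) / 2)) = Real.sqrt (4 * xP ^ 3 - 28 * xP + 24) := by
    have hidx : (((3 : ℕ) : ℤ) - 1) = 2 := by norm_num
    rw [hidx, WeierstrassCurve.ψ_two, WeierstrassCurve.ψ₂, WeierstrassCurve.Affine.evalEval_polynomialY]
    simp only [zero_mul, add_zero]
    ring
  rw [hψ₂, abs_of_pos hyPpos, Real.log_sqrt hfP.le] at hpin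
  have hD : (3 * (2 : ℝ) ^ 2 - 28 / 4) = 5 := by norm_num
  rw [hD] at hpin
  push_cast at hpin
  have hlogq : Real.log ((4 * xP ^ 3 - 28 * xP + 24) ^ 2 / 125)
      = 2 * Real.log (4 * xP ^ 3 - 28 * xP + 24) - 3 * Real.log 5 := by
    rw [Real.log_div (by positivity) (by norm_num), Real.log_pow,
      show (125 : ℝ) = 5 ^ 3 by norm_num, Real.log_pow]
    push_cast
    ring
  have hcB : (c : ℝ) * Real.log B = 3 * Real.log ((4 * xP ^ 3 - 28 * xP + 24) ^ 2 / 125) := by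
    rw [hlogq]
    linarith
  -- interval-log relation: `c•[log B] − 3•[log (f(x_P)²/125)] ∈ relations`
  have hlog : c • KZ.of rB + (-3 : ℤ) • KZ.of rL ∈ KZ.relations := by
    have h := interval_log_relation_mem_relations 2 ![1, 1]
      ![B, (4 * xP ^ 3 - 28 * xP + 24) ^ 2 / 125] ![c, -3] ![rB, rL] ?_ ?_ ?_ ?_ ?_ ?_
    · simpa [Fin.sum_univ_two] using h
    · intro i; fin_cases i <;> simp
    · intro i; fin_cases i
      · simpa using hB1.le
      · simpa using hsq
    · intro i; fin_cases i <;> simpa using isAlgebraic_one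
    · intro i; fin_cases i
      · simpa using hBalg
      · simpa using hfalg
    · intro i; fin_cases i
      · exact ⟨hBdom, fun z hz => (hBint hz).trans (one_div (z 0)).symm⟩
      · exact ⟨hLdom, fun z hz => (hLint hz).trans (one_div (z 0)).symm⟩
    · simp only [Fin.sum_univ_two, Matrix.cons_val_zero, Matrix.cons_val_one, div_one, Int.cast_neg,
        Int.cast_ofNat]
      rw [hcB]
      ring
  -- assemble: `36•[rI] + [rP] − 3•[rL] = (rung element) + (log relation)`
  have key : (36 : ℤ) • KZ.of rI + KZ.of rP - (3 : ℤ) • KZ.of rL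
      = ((36 : ℤ) • KZ.of rI + KZ.of rP - c • KZ.of rB) + (c • KZ.of rB + (-3 : ℤ) • KZ.of rL) := by
    module
  rw [key]
  exact KZ.relations.add_mem hchain' hlog

end Summit.KontsevichZagierPeriods.KontsevichZagierPeriods.TorsionLogs.NeronHeight

end
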